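import Summits.HubbardSuperconductivity.HubbardSuperconductivity.Theorems.AnisotropyChordTransferFsumIdentity

/-!
# Route `AnisotropyChord` / H0 rotor rung, route (1): HYPOTHESIS F of PROPOSITION N — part 2, ONE BOND CONSTANT and the
# TRIGONOMETRIC SUM: `f-sum ≥ exchange correlation`
# (theory seat `hubbard-h0-rotor-theory-1` g12, memo ROTOR-THEORY-12 §184(h); critic-4 g9 P5; prover seat `hubbard-h0-rotor-p1` g15)

Continuing `…TransferFsumIdentity` (`fsumC = ⅛ Σ_{x∼y} (c_x − c_y)² hopCorr a x y`):

* `axisSwap` / `axisSwapIso` — the coordinate swap `(x₀, x₁) ↦ (x₁, x₀)` is an automorphism of the torus graph `(ℤ/L)²`;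
* **`hopCorr_perron_adj`** — a Perron sector amplitude (translation invariant by `perronTranslationInvariant_holds`, swap
  invariant by `perronAmplitude_comp_iso`) has ONE exchange correlation `h₀ = hopCorr a 0 e₀` on every directed bond;
* `sum_siteCos_sub_sq` — `Σ_x (cos(2πx₀/L) − cos(2π(x₀+1)/L))² = L²(1 − cos(2π/L))` for `L ≥ 3` (characters of `(ℤ/L)²`:
  `Σ_x χ_{2e₀}(x) = 0`), and `eight_le_sq_mul_one_sub_cos` — `8 ≤ L²(1 − cos(2π/L))` (Jordan's inequality);
* **`hopCorr_le_fsumC`** — `h₀ ≤ fsumC L Δ M a` for `L ≥ 3` (keep only the bonds `(x, x + e₀)` in the bond sum).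

All folklore (lattice f-sum rule; finite Fourier analysis).
-/

set_option linter.dupNamespace false
set_option autoImplicit false

noncomputable section

open Finset Filter Topology
open Literature.MathematicalPhysics.QuantumLattice Literature.Probability.LatticeModels
open Summit.HubbardSuperconductivity.HubbardSuperconductivity.Theorems.AnisotropyChord.InsertionEntropy
open Summit.HubbardSuperconductivity.HubbardSuperconductivity.Theorems.AnisotropyChord.Tower

namespace Summit.HubbardSuperconductivity.HubbardSuperconductivity.Theorems.AnisotropyChord.Transfer

/-! ## The coordinate swap is a torus automorphism -/

section Swap

variable {L : ℕ}

/-- the coordinate swap `(x₀, x₁) ↦ (x₁, x₀)` of `(ℤ/L)²`. [folklore] -/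
def axisSwap (L : ℕ) : TorusSite 2 L ≃ TorusSite 2 L where
  toFun x := fun i => x (Equiv.swap 0 1 i)
  invFun x := fun i => x (Equiv.swap 0 1 i)
  left_inv x := by funext i; simp only [Equiv.swap_apply_self]
  right_inv x := by funext i; simp only [Equiv.swap_apply_self]

/-- `axisSwap` in coordinates. [folklore] -/
theorem axisSwap_apply (x : TorusSite 2 L) (i : Fin 2) : axisSwap L x i = x (Equiv.swap 0 1 i) := rfl

/-- `axisSwap` is additive. [folklore] -/
theorem axisSwap_add (x y : TorusSite 2 L) : axisSwap L (x + y) = axisSwap L x + axisSwap L y := rfl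

/-- `axisSwap 0 = 0`. [folklore] -/
theorem axisSwap_zero : axisSwap L 0 = 0 := rfl

/-- `axisSwap` is an involution. [folklore] -/
theorem axisSwap_axisSwap (x : TorusSite 2 L) : axisSwap L (axisSwap L x) = x := (axisSwap L).left_inv x

/-- `axisSwap` exchanges the two unit vectors. [folklore] -/
theorem axisSwap_single (i : Fin 2) : axisSwap L (Pi.single i (1 : ZMod L)) = Pi.single (Equiv.swap 0 1 i) 1 := by
  funext j
  rw [axisSwap_apply]
  rcases Stiffness.Doob.fin2_eq_zero_or_one i with rfl | rfl <;>
    rcases Stiffness.Doob.fin2_eq_zero_or_one j with rfl | rfl <;> simp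

/-- Adjacency of the torus is preserved by `axisSwap` (one direction). [folklore] -/
theorem torusGraph_adj_axisSwap {x y : TorusSite 2 L} (h : (torusGraph 2 L).Adj x y) :
    (torusGraph 2 L).Adj (axisSwap L x) (axisSwap L y) := by
  rw [torusGraph_adj_iff] at h ⊢
  obtain ⟨hne, hor⟩ := h
  refine ⟨fun heq => hne ((axisSwap L).injective heq), ?_⟩
  rcases hor with ⟨i, hi⟩ | ⟨i, hi⟩
  · exact Or.inl ⟨Equiv.swap 0 1 i, by rw [hi, axisSwap_add, axisSwap_single]⟩
  · exact Or.inr ⟨Equiv.swap 0 1 i, by rw [hi, axisSwap_add, axisSwap_single]⟩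

/-- **The coordinate swap is an automorphism of the torus graph.** [folklore] -/
def axisSwapIso (L : ℕ) : torusGraph 2 L ≃g torusGraph 2 L where
  toEquiv := axisSwap L
  map_rel_iff' := by
    intro x y
    constructor
    · intro h
      have h2 := torusGraph_adj_axisSwap h
      rw [axisSwap_axisSwap, axisSwap_axisSwap] at h2
      exact h2
    · exact torusGraph_adj_axisSwap

end Swap

/-! ## Every directed bond carries the same exchange correlation -/

section Bonds

variable {L : ℕ} [NeZero L]

/-- translations do not change the exchange correlation of a Perron amplitude. [folklore] -/
theorem hopCorr_perron_translate {Δ M : ℝ} {a : TensorIndex (TorusSite 2 L) 2 → ℝ}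
    (ha : IsPerronSectorGroundAmplitude L Δ M a) (x y v : TorusSite 2 L) :
    hopCorr a (x + v) (y + v) = hopCorr a x y :=
  hopCorr_map_equiv a (Equiv.addRight v) (fun σ => perronTranslationInvariant_holds Δ L M a ha v σ) x y

/-- the coordinate swap does not change the exchange correlation of a Perron amplitude. [folklore] -/
theorem hopCorr_perron_axisSwap {Δ M : ℝ} {a : TensorIndex (TorusSite 2 L) 2 → ℝ}
    (ha : IsPerronSectorGroundAmplitude L Δ M a) (x y : TorusSite 2 L) :
    hopCorr a (axisSwap L x) (axisSwap L y) = hopCorr a x y :=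
  hopCorr_map_equiv a (axisSwap L) (fun σ => perronAmplitude_comp_iso L Δ M a ha (axisSwapIso L) σ) x y

/-- every directed bond `(x, x + eᵢ)` carries `hopCorr a 0 e₀`. [folklore] -/
theorem hopCorr_perron_single {Δ M : ℝ} {a : TensorIndex (TorusSite 2 L) 2 → ℝ}
    (ha : IsPerronSectorGroundAmplitude L Δ M a) (x : TorusSite 2 L) (i : Fin 2) :
    hopCorr a x (x + Pi.single i 1) = hopCorr a 0 (Pi.single 0 1) := by
  have h1 : hopCorr a x (x + Pi.single i 1) = hopCorr a 0 (Pi.single i 1) := by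
    have := hopCorr_perron_translate ha 0 (Pi.single i 1) x
    rw [zero_add, add_comm] at this
    exact this
  rw [h1]
  rcases Stiffness.Doob.fin2_eq_zero_or_one i with rfl | rfl
  · rfl
  · have h2 := hopCorr_perron_axisSwap ha (0 : TorusSite 2 L) (Pi.single 0 1)
    rw [axisSwap_zero, axisSwap_single, Equiv.swap_apply_left] at h2
    exact h2

/-- **ONE BOND CONSTANT:** a Perron sector amplitude has the same exchange correlation `hopCorr a 0 e₀` on every directed bond
of the torus (translation and coordinate-swap invariance + symmetry of `hopCorr`). [folklore] -/
theorem hopCorr_perron_adj {Δ M : ℝ} {a : TensorIndex (TorusSite 2 L) 2 → ℝ}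
    (ha : IsPerronSectorGroundAmplitude L Δ M a) {x y : TorusSite 2 L} (hxy : (torusGraph 2 L).Adj x y) :
    hopCorr a x y = hopCorr a 0 (Pi.single 0 1) := by
  obtain ⟨-, ⟨i, hi⟩ | ⟨i, hi⟩⟩ := (torusGraph_adj_iff x y).1 hxy
  · rw [hi]; exact hopCorr_perron_single ha x i
  · rw [← hopCorr_symm, hi]; exact hopCorr_perron_single ha y i

end Bonds

/-! ## The trigonometric sum `Σ_x (c_x − c_{x+e₀})² = L²(1 − cos(2π/L))` -/

section Trig

variable {L : ℕ} [NeZero L]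

/-- the site cosine is the real part of the character `χ_{e₀}` (`L ≥ 2`). [folklore] -/
theorem siteCos_eq_re (hL : 2 ≤ L) (s : TorusSite 2 L) :
    siteCos L s = (torusChar (Pi.single (0 : Fin 2) (1 : ZMod L)) s).re := by
  rw [Literature.Probability.LatticeModels.torusChar_re]
  unfold siteCos latticeMomentum
  congr 1
  rw [Fin.sum_univ_two]
  have h0 : ((Pi.single (0 : Fin 2) (1 : ZMod L) : TorusSite 2 L) 0).val = 1 := by
    rw [Pi.single_eq_same]
    haveI : Fact (1 < L) := ⟨hL⟩
    exact ZMod.val_one L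
  have h1 : ((Pi.single (0 : Fin 2) (1 : ZMod L) : TorusSite 2 L) 1).val = 0 := by
    rw [Pi.single_eq_of_ne (by decide : (1 : Fin 2) ≠ 0), ZMod.val_zero]
  rw [h0, h1]
  push_cast
  ring

/-- `|χ_k(x)|² = 1`. [folklore] -/
theorem normSq_torusChar (k x : TorusSite 2 L) : Complex.normSq (torusChar k x) = 1 := by
  rw [Complex.normSq_eq_norm_sq, norm_torusChar, one_pow]

omit [NeZero L] in
/-- two steps along axis `0` do not close up: `e₀ + e₀ ≠ 0` in `(ℤ/L)²` for `L ≥ 3`. [folklore] -/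
theorem single_add_single_ne_zero (hL : 3 ≤ L) :
    (Pi.single (0 : Fin 2) (1 : ZMod L) : TorusSite 2 L) + Pi.single 0 1 ≠ 0 := by
  intro h
  have h1 := congr_fun h 0
  simp only [Pi.add_apply, Pi.single_eq_same, Pi.zero_apply] at h1
  have h2 : ((2 : ℕ) : ZMod L) = 0 := by
    rw [show ((2 : ℕ) : ZMod L) = 1 + 1 by push_cast; norm_num]
    exact h1
  rw [ZMod.natCast_eq_zero_iff] at h2
  exact absurd (Nat.le_of_dvd two_pos h2) (by omega)

/-- **the trigonometric sum:** `Σ_x (cos(2πx₀/L) − cos(2π(x₀+1)/L))² = L² (1 − cos(2π/L))` for `L ≥ 3`. [folklore] -/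
theorem sum_siteCos_sub_sq (hL : 3 ≤ L) :
    ∑ x : TorusSite 2 L, (siteCos L x - siteCos L (x + Pi.single 0 1)) ^ 2
      = ((L : ℝ) ^ 2) * (1 - Real.cos (2 * Real.pi / (L : ℝ))) := by
  have hL2 : 2 ≤ L := le_trans (by norm_num) hL
  set e₀ : TorusSite 2 L := Pi.single 0 1 with he
  set ω : ℂ := torusChar e₀ e₀ with hω
  have hχ : ∀ x : TorusSite 2 L, siteCos L x - siteCos L (x + e₀) = (torusChar e₀ x * (1 - ω)).re := by
    intro x
    rw [siteCos_eq_re hL2, siteCos_eq_re hL2, torusChar_add_right, mul_sub, mul_one, Complex.sub_re]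
  have hω_re : ω.re = Real.cos (2 * Real.pi / (L : ℝ)) := by
    rw [hω, ← siteCos_eq_re hL2]
    unfold siteCos
    rw [he, Pi.single_eq_same]
    haveI : Fact (1 < L) := ⟨hL2⟩
    rw [ZMod.val_one]
    push_cast
    ring_nf
  have hns : Complex.normSq (1 - ω) = 2 * (1 - ω.re) := by
    rw [Complex.normSq_sub, Complex.normSq_one, normSq_torusChar, one_mul, Complex.conj_re]
    ring
  have hsum2 : ∑ x : TorusSite 2 L, torusChar e₀ x ^ 2 = 0 := by
    have h2 : ∀ x : TorusSite 2 L, torusChar e₀ x ^ 2 = torusChar (e₀ + e₀) x := fun x => by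
      rw [pow_two, torusChar_comm (e₀ + e₀), torusChar_add_right, torusChar_comm x e₀]
    simp only [h2]
    rw [sum_torusChar_right, if_neg (single_add_single_ne_zero hL)]
  -- `(Re w)² = (|w|² + Re(w²))/2`
  have re_sq : ∀ w : ℂ, w.re ^ 2 = (Complex.normSq w + (w ^ 2).re) / 2 := fun w => by
    rw [Complex.normSq_apply, pow_two w, Complex.mul_re]; ring
  calc ∑ x : TorusSite 2 L, (siteCos L x - siteCos L (x + e₀)) ^ 2
      = ∑ x : TorusSite 2 L, (Complex.normSq (1 - ω) + (torusChar e₀ x ^ 2 * (1 - ω) ^ 2).re) / 2 := by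
        refine Finset.sum_congr rfl fun x _ => ?_
        rw [hχ x, re_sq, Complex.normSq_mul, normSq_torusChar, one_mul, mul_pow]
    _ = ((Fintype.card (TorusSite 2 L) : ℝ) * Complex.normSq (1 - ω)
          + ((∑ x : TorusSite 2 L, torusChar e₀ x ^ 2) * (1 - ω) ^ 2).re) / 2 := by
        rw [← Finset.sum_div, Finset.sum_add_distrib, Finset.sum_const, Finset.card_univ, nsmul_eq_mul,
          Finset.sum_mul, Complex.re_sum]
    _ = ((L : ℝ) ^ 2) * (1 - Real.cos (2 * Real.pi / (L : ℝ))) := by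
        have hcardT : Fintype.card (TorusSite 2 L) = L ^ 2 := by rw [Fintype.card_fun, ZMod.card, Fintype.card_fin]
        rw [hsum2, zero_mul, Complex.zero_re, add_zero, hns, hω_re, hcardT]
        push_cast
        ring

omit [NeZero L] in
/-- **Jordan:** `8 ≤ L² (1 − cos(2π/L))` for `L ≥ 2` (`1 − cos 2x = 2 sin² x` and `sin x ≥ (2/π) x` on `[0, π/2]`). [folklore] -/
theorem eight_le_sq_mul_one_sub_cos (hL : 2 ≤ L) :
    8 ≤ ((L : ℝ) ^ 2) * (1 - Real.cos (2 * Real.pi / (L : ℝ))) := by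
  have hLpos : (0 : ℝ) < L := by exact_mod_cast (by omega : 0 < L)
  have hL2 : (2 : ℝ) ≤ L := by exact_mod_cast hL
  have hx0 : 0 ≤ Real.pi / L := by positivity
  have hx1 : Real.pi / L ≤ Real.pi / 2 := div_le_div_of_nonneg_left Real.pi_pos.le (by norm_num) hL2
  have hsin := Real.mul_le_sin hx0 hx1
  have h2L : 2 / Real.pi * (Real.pi / L) = 2 / L := by field_simp
  rw [h2L] at hsin
  have hcos : 1 - Real.cos (2 * Real.pi / L) = 2 * Real.sin (Real.pi / L) ^ 2 := by
    rw [show 2 * Real.pi / (L : ℝ) = 2 * (Real.pi / L) by ring, Real.cos_two_mul]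
    linear_combination (-2 : ℝ) * Real.sin_sq_add_cos_sq (Real.pi / L)
  have hsq : (2 / (L : ℝ)) ^ 2 ≤ Real.sin (Real.pi / L) ^ 2 := pow_le_pow_left₀ (by positivity) hsin 2
  have h4 : ((L : ℝ) ^ 2) * (2 / (L : ℝ)) ^ 2 = 4 := by field_simp; ring
  rw [hcos]
  nlinarith [hsq, h4, sq_nonneg (L : ℝ)]

end Trig

/-! ## `f-sum ≥ exchange correlation` -/

section Fsum

variable {L : ℕ} [NeZero L]

/-- **f-SUM ≥ EXCHANGE CORRELATION:** for a Perron sector amplitude `a` and `L ≥ 3`,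
`hopCorr a 0 e₀ ≤ fsumC L Δ M a` (keep the bonds `(x, x + e₀)` in `fsumC_eq_bond_sum`, all carrying `hopCorr a 0 e₀`, and use
`Σ_x (c_x − c_{x+e₀})² = L²(1 − cos(2π/L)) ≥ 8`). [folklore: lattice f-sum rule] -/
theorem hopCorr_le_fsumC {Δ M : ℝ} {a : TensorIndex (TorusSite 2 L) 2 → ℝ}
    (ha : IsPerronSectorGroundAmplitude L Δ M a) (hL : 3 ≤ L) :
    hopCorr a 0 (Pi.single 0 1) ≤ fsumC L Δ M a := by
  have hL2 : 2 ≤ L := le_trans (by norm_num) hL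
  set h₀ := hopCorr a 0 (Pi.single 0 1) with hh₀
  have h0nn : 0 ≤ h₀ := hopCorr_nonneg ha.nonneg _ _
  rw [fsumC_eq_bond_sum ha]
  -- keep only the bonds `(x, x + e₀)`
  have hdrop : ∀ x : TorusSite 2 L, (siteCos L x - siteCos L (x + Pi.single 0 1)) ^ 2 * h₀
      ≤ ∑ y, if (torusGraph 2 L).Adj x y then (siteCos L x - siteCos L y) ^ 2 * hopCorr a x y else 0 := by
    intro x
    have hnn : ∀ y ∈ (Finset.univ : Finset (TorusSite 2 L)),
        0 ≤ (if (torusGraph 2 L).Adj x y then (siteCos L x - siteCos L y) ^ 2 * hopCorr a x y else 0) := by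
      intro y _
      split_ifs
      · exact mul_nonneg (sq_nonneg _) (hopCorr_nonneg ha.nonneg _ _)
      · exact le_rfl
    have h := Finset.single_le_sum hnn (Finset.mem_univ (x + Pi.single 0 1))
    rw [if_pos (torusGraph_adj_add_single hL2 x 0), hopCorr_perron_single ha x 0] at h
    exact h
  have hsum : (∑ x : TorusSite 2 L, (siteCos L x - siteCos L (x + Pi.single 0 1)) ^ 2) * h₀
      ≤ ∑ x : TorusSite 2 L, ∑ y,
          if (torusGraph 2 L).Adj x y then (siteCos L x - siteCos L y) ^ 2 * hopCorr a x y else 0 := by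
    rw [Finset.sum_mul]; exact Finset.sum_le_sum fun x _ => hdrop x
  rw [sum_siteCos_sub_sq hL] at hsum
  have h8 := eight_le_sq_mul_one_sub_cos hL2
  calc h₀ = (1/8 : ℝ) * (8 * h₀) := by ring
    _ ≤ (1/8 : ℝ) * (((L : ℝ) ^ 2) * (1 - Real.cos (2 * Real.pi / (L : ℝ))) * h₀) := by
        gcongr
    _ ≤ (1/8 : ℝ) * ∑ x : TorusSite 2 L, ∑ y,
          if (torusGraph 2 L).Adj x y then (siteCos L x - siteCos L y) ^ 2 * hopCorr a x y else 0 :=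
        mul_le_mul_of_nonneg_left hsum (by norm_num)

end Fsum

end Summit.HubbardSuperconductivity.HubbardSuperconductivity.Theorems.AnisotropyChord.Transfer
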